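import Literature.MathematicalPhysics.QuantumFieldTheory.QCDCalibratedSpecies
import Literature.MathematicalPhysics.QuantumFieldTheory.QCDGoldstoneBound
import HarnessLib

/-!
# Reindexing a calibrated species family along a subsequence of cutoff steps

Companion to `QCDCalibratedSpecies` (calibrated species renormalisations `𝒞 : CalibratedSpeciesFamily reg`, Montvay–Münster
§1.7 (1.251)–(1.253)) and to `QCDRegularisation.restrict` of `QCDGoldstoneBound` (the regularisation read along `φ → ∞`).
Continuum limits of lattice QCD are extracted along SUBSEQUENCES of the cutoff steps (UV stability gives subsequential
limits only: Jaffe–Witten §5; Glimm–Jaffe §6.1); the renormalisation convention must ride along.  This file provides the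
bookkeeping: `CalibratedSpeciesFamily.reindex 𝒞 ψ hψ` is the family over `reg.restrict ψ hψ` with the same calibration
distance and reference function and the renormalisations `z_s(m, ψ k)`, `shift_s(m, ψ k)`; its lattice `n`-point functions
at step `k` ARE those of `𝒞` at step `ψ k` (`qcdLatticeSchwinger_reindex`, definitional), so the one-point subtraction and the
two-point calibration are inherited.  Nothing here is specific to QCD dynamics. [folklore]

Sources: I. Montvay, G. Münster, *Quantum Fields on a Lattice* (1994) §1.7, §5.1 [MontvayMunster1994]; A. Jaffe, E. Witten,
*Quantum Yang–Mills theory* (2000) §5 [JaffeWitten2000].  Deliberately NOT here: any convergence statement.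
-/

noncomputable section

namespace Literature.MathematicalPhysics.QuantumFieldTheory

open _root_.Filter
open scoped SchwartzMap

variable {Nf : ℕ} {reg : QCDRegularisation Nf}

namespace CalibratedSpeciesFamily

/-- **The reindexed calibrated family** `𝒞.reindex ψ hψ` over `reg.restrict ψ hψ` (`ψ → ∞`): same calibration distance `τ₀`
and reference function `f₀`, renormalisations `z_s(m, ψ k)` and counterterms `shift_s(m, ψ k)`.  The one-point subtraction
and the calibration identity at step `k` are those of `𝒞` at step `ψ k`, because the lattice `n`-point functions of the
reindexed scheme are the reindexed ones definitionally. [folklore] -/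
def reindex (𝒞 : CalibratedSpeciesFamily reg) (ψ : ℕ → ℕ) (hψ : Tendsto ψ atTop atTop) :
    CalibratedSpeciesFamily (reg.restrict ψ hψ) where
  τ₀ := 𝒞.τ₀
  τ₀_pos := 𝒞.τ₀_pos
  f₀ := 𝒞.f₀
  f₀_ne_zero := 𝒞.f₀_ne_zero
  tsupport_f₀ := 𝒞.tsupport_f₀
  z m s k := 𝒞.z m s (ψ k)
  shift m s k := 𝒞.shift m s (ψ k)
  z_pos m s k := 𝒞.z_pos m s (ψ k)
  onePointSubtracted m s k f := 𝒞.onePointSubtracted m s (ψ k) f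
  calibrated m s k := 𝒞.calibrated m s (ψ k)

variable (𝒞 : CalibratedSpeciesFamily reg) (ψ : ℕ → ℕ) (hψ : Tendsto ψ atTop atTop)

/-- The reference function of the reindexed family is that of `𝒞`. [folklore] -/
@[simp] theorem reindex_f₀ : (𝒞.reindex ψ hψ).f₀ = 𝒞.f₀ := rfl

/-- The calibration distance of the reindexed family is that of `𝒞`. [folklore] -/
@[simp] theorem reindex_τ₀ : (𝒞.reindex ψ hψ).τ₀ = 𝒞.τ₀ := rfl

/-- The renormalisations of the reindexed family are the reindexed ones. [folklore] -/
@[simp] theorem reindex_z (m : Fin Nf → ℝ) (s : QCDField Nf) (k : ℕ) : (𝒞.reindex ψ hψ).z m s k = 𝒞.z m s (ψ k) := rfl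

/-- The counterterms of the reindexed family are the reindexed ones. [folklore] -/
@[simp] theorem reindex_shift (m : Fin Nf → ℝ) (s : QCDField Nf) (k : ℕ) :
    (𝒞.reindex ψ hψ).shift m s k = 𝒞.shift m s (ψ k) := rfl

/-- **The lattice `n`-point functions of the reindexed family are the reindexed ones** (definitional: spacing, coupling,
torus, bare masses and `z, shift` at step `k` of the left side are those at step `ψ k` of the right side). [folklore] -/
theorem qcdLatticeSchwinger_reindex (m : Fin Nf → ℝ) (k n : ℕ) (σ : Fin n → QCDField Nf)
    (f : Fin n → 𝓢(EuclideanSpace ℝ (Fin 4), ℝ)) :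
    qcdLatticeSchwinger ((𝒞.reindex ψ hψ).scheme m) k n σ f = qcdLatticeSchwinger (𝒞.scheme m) (ψ k) n σ f :=
  rfl

/-- The one-point functions of the reindexed family are the reindexed ones. [folklore] -/
theorem onePoint_reindex (m : Fin Nf → ℝ) (k : ℕ) :
    ((𝒞.reindex ψ hψ).scheme m).onePoint k = (𝒞.scheme m).onePoint (ψ k) :=
  rfl

/-- The two-point functions of the reindexed family are the reindexed ones. [folklore] -/
theorem twoPoint_reindex (m : Fin Nf → ℝ) (k : ℕ) :
    ((𝒞.reindex ψ hψ).scheme m).twoPoint k = (𝒞.scheme m).twoPoint (ψ k) :=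
  rfl

/-- The bare-mass trajectories of the reindexed family are the reindexed ones. [folklore] -/
theorem reindex_scheme_mq (m : Fin Nf → ℝ) (fl : Fin Nf) (k : ℕ) :
    ((𝒞.reindex ψ hψ).scheme m).mq fl k = (𝒞.scheme m).mq fl (ψ k) :=
  rfl

end CalibratedSpeciesFamily

end Literature.MathematicalPhysics.QuantumFieldTheory

end
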